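import Summits.BirchSwinnertonDyer.BirchSwinnertonDyer.Theorems.KatoDescentPotSupersingularWildUpperReducibleNineTorsionStructure
import Literature.NumberTheory.EllipticCurves.KubertTateNineLocalDataThree
import HarnessLib

/-!
# Route `KatoDescentPotSupersingular` (rung K9, cell `bsd-potss`), crux `WildUpperReducibleDefect` (item
# stmt-BirchSwinnertonDyer-19190), registered stub `stub_red_nineTorsionMember`: the `ℤ/9` member of every row is of
# KODAIRA TYPE `IV` AT `3` EXACTLY, with `f₃ = 3` and `ord₃ Δ_min = 5` — UNCONDITIONALLY. ROUTE-FREE (imports no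
# `Theses.*` file); a `--supports 19190 --as helper` file (seat `bsd-potss-k9-red9` g6); nothing booked, BSD is not
# proved by any of this

THE POINT. The stub's rows are the analytic-rank-`0` wild-`3` (class O6) rows with `E[3]` reducible whose `ℚ`-isogeny
class contains a curve `W'` with `3² ∣ #W'(ℚ)_tors`; the seat's earlier files typed them structurally (g5:
`…NineTorsionLocal` / `…NineTorsionStructure`: `W'` carries a rational point of order `9`, the class is semistable
away from `3`, `c₃(W') = 3`, Kodaira type `IV` OR `IV*` at `3`) and reduced the stub to Kubert's universal `ℤ/9`
family `E₉(f)` (`…NineTorsionKubert`, Literature `KubertTateNine`). The Literature files `KubertTateNineInvariants` /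
`KubertTateNineValuationsThree` / `KubertTateNineLocalDataThree` (this seat, g6) PROVE the local data of that family
at `3` (Barrios–Roy 2022, Thm. 3.8, row `T = C₉`) through the tree's proved Table II bridges (Rizzo / Papadopoulos,
`kodairaSymbolAt_eq_tableKodairaSymbolThree`, `conductorExponent_eq_tableConductorExponentThree_holds`): in Kubert's
chart the curve is additive at `3` iff `3 ∣ num(f) + den(f)`, and then `(v₃ c₄, v₃ c₆, v₃ Δ) = (2, 3, 5)`, row
`(2,3,5)`: type `IV`, `f₃ = 3`; otherwise it is multiplicative `I₉ₑ`. READ ON ONE CURVE and ON THE STUB'S ROWS: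

* §1 **a curve over `ℚ` with a rational point of order `9` is never of good reduction at `3`**
  (`not_hasGoodReductionAtPrime_three_of_addOrderOf_eq_nine`); **if it is additive at `3`** (`Addv`, any
  equation) **then its Kodaira type at `3` is `IV`** — not `IV*` — (`kodairaSymbolAt_three_eq_IV_of_addOrderOf_eq_nine`,
  sharpening g5's `kodairaSymbolAt_three_eq_IV_or_IVstar_of_nine_dvd_torsionOrder`), **`f₃ = 3`**
  (`conductorExponent_three_eq_three_of_addOrderOf_eq_nine`: `v₃(N) = 3`, the census conductors `27·2`, `27·70`,
  `27·4522`) and **`ord₃ Δ_min = 5`** (`ordMinimalDiscriminant_three_eq_five_of_addOrderOf_eq_nine`, Ogg); in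
  Kubert's chart additivity at `3` is EXACTLY `3 ∣ num(f) + den(f)` (`three_dvd_num_add_den_of_addv`,
  `addv_three_iff_three_dvd_num_add_den`).
* §2 **on every row of the stub** (`W` with `Addv W 3`, in particular every `ClassO6 W 3` row, `W ∼ W'`,
  `3² ∣ #W'(ℚ)_tors`): the `ℤ/9` member `W'` is of type `IV` at `3` with `f₃(W') = 3`, `ord₃ Δ_min(W') = 5`
  (`nineTorsionMember_kodairaIV`, `nineTorsionMember_kodairaIV_of_classO6`). The conductor exponent of `W` itself
  is then `3` granted the isogeny invariance of the conductor (Serre–Tate; in the tree only conditionally, e.g.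
  `conductorNorm_eq_of_isIsogenous_of_modular`) — not restated here.

Cross-check outside Lean (not an input): PARI `elllocalred` on 17 541 curves `E₉(m/n)`, `|m|, n ≤ 120`: 4 369 additive,
all `[f₃, Kod, c₃] = [3, IV, 3]`, `N = 27·(squarefree prime to 3)`; 13 172 multiplicative `I₉ₑ` (kit job j267526).

WHAT THIS IS NOT: not a bound on `Ш`; the stub is not advanced class-wide (it remains Kato's count-fact road, item
settled-by-citation via glue 19711); nothing is booked; no item is closed. HONEST RESIDUE unchanged.

References: [BarriosRoy2022LocalData] Thm. 3.8 (table, `T = C₉`) and §3.5 Case 3; [Rizzo2003] Table II rows `(2,3,5)`,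
`(0,0,≥1)`; [SilvermanATAEC1994] IV.9.4, IV.11.1 (Ogg's formula), Table 4.1; [Kubert1976] Table 3 (`N = 9`).
-/

set_option autoImplicit false
-- the Theorems directory repeats the summit name (sibling precedent `KatoDescentPotSupersingularAssembly.lean`)
set_option linter.dupNamespace false

noncomputable section

open scoped Classical

namespace Summit.BirchSwinnertonDyer.BirchSwinnertonDyer.Theorems.WildUpperReducibleNineTorsionKodaira

open WeierstrassCurve IsDedekindDomain Literature.NumberTheory.EllipticCurves
  Literature.NumberTheory.DiophantineGeometry
  Literature.NumberTheory.EllipticCurves.Rank1Residual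
  Summit.BirchSwinnertonDyer.Rank1Residual
  Summit.BirchSwinnertonDyer.Rank1Residual.Additive
  Summit.BirchSwinnertonDyer.BirchSwinnertonDyer.Theorems.WildUpperReducibleNineTorsionLocal
  Summit.BirchSwinnertonDyer.BirchSwinnertonDyer.Theorems.WildUpperReducibleNineTorsionStructure

/-! ## §1 One curve with a rational point of order `9` -/

section OneCurve

variable (W : WeierstrassCurve ℚ) [W.IsElliptic] [Fact (Nat.Prime 3)]

/-- **In Kubert's chart, additive at `3` forces the fibre `3 ∣ num(f) + den(f)`**: if `C • W = E₉(f)` and `W` is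
additive at `3` then `3 ∣ num(f) + den(f)` (off that fibre Tate's algorithm returns `I₉ₑ`, `e ≥ 1`, which is
multiplicative). [cite: BarriosRoy2022LocalData, Thm. 3.8 (table, T = C₉: additive at 3 iff v₃(a + b) ≥ 1)] -/
theorem three_dvd_num_add_den_of_addv (hadd : Addv W 3) {f : ℚ} {C : VariableChange ℚ}
    (hC : C • W = kubertTate (f ^ 2 * (f - 1) * (f ^ 2 - f + 1)) (f ^ 2 * (f - 1))) :
    (3 : ℤ) ∣ f.num + f.den := by
  by_contra h
  obtain ⟨hK, hE⟩ := kodairaSymbolAt_eq_I_of_smul_eq_kubertTate_nine hC h (ringChar_int_quot_placeOf 3)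
  have hA := isAdditive_kodairaSymbolAt_placeOf_of_addv W 3 hadd
  exact hA.2 ⟨_, by omega, hK⟩

/-- **Conversely the fibre `3 ∣ num(f) + den(f)` is additive at `3`** (type `IV` is neither `I₀` nor `Iₙ`;
prime/place bridges `hasGoodReductionAtPrime_iff_hasGoodReductionAt_holds`,
`hasMultiplicativeReductionAtPrime_iff_hasMultiplicativeReductionAt_holds`, Tate's algorithm
`isGood_kodairaSymbolAt_iff_holds` / `kodairaSymbolAt_eq_I_iff_holds`), so that in Kubert's chart
**`Addv W 3 ↔ 3 ∣ num(f) + den(f)`**. [cite: BarriosRoy2022LocalData, Thm. 3.8 (table, T = C₉: additive at 3 iff v₃(a + b) ≥ 1)] -/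
theorem addv_three_iff_three_dvd_num_add_den {f : ℚ} {C : VariableChange ℚ}
    (hC : C • W = kubertTate (f ^ 2 * (f - 1) * (f ^ 2 - f + 1)) (f ^ 2 * (f - 1))) :
    Addv W 3 ↔ (3 : ℤ) ∣ f.num + f.den := by
  refine ⟨fun hadd ↦ three_dvd_num_add_den_of_addv W hadd hC, fun h3 ↦ ?_⟩
  have hIV := kodairaSymbolAt_eq_IV_of_smul_eq_kubertTate_nine hC h3 (ringChar_int_quot_placeOf 3)
  refine ⟨fun hg ↦ ?_, fun hm ↦ ?_⟩
  · have h0 : (W.kodairaSymbolAt (placeOf 3)).IsGood :=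
      (isGood_kodairaSymbolAt_iff_holds (placeOf 3) W).mpr
        ((W.hasGoodReductionAtPrime_iff_hasGoodReductionAt_holds ⟨3, Fact.out⟩).mp hg)
    rw [hIV] at h0
    exact absurd h0 (by simp [KodairaSymbol.IsGood])
  · haveI : PerfectField (IsLocalRing.ResidueField ((placeOf 3).adicCompletionIntegers ℚ)) :=
      PerfectField.ofFinite
    have hA : (W.kodairaSymbolAt (placeOf 3)).IsAdditive := by
      rw [hIV]
      simp [KodairaSymbol.IsAdditive, KodairaSymbol.IsGood, KodairaSymbol.IsMultiplicative]
    exact ((isAdditive_kodairaSymbolAt_iff_holds (placeOf 3) W).mp hA).not_hasMultiplicativeReductionAt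
      ((W.hasMultiplicativeReductionAtPrime_iff_hasMultiplicativeReductionAt_holds ⟨3, Fact.out⟩).mp hm)

/-- **A curve over `ℚ` with a rational point of order `9` that is additive at `3` has Kodaira type `IV` at `3`**
(not `IV*`): Kubert's chart (`exists_kubertTate_nine_of_addOrderOf_eq_nine`), the fibre `3 ∣ num + den`
(`three_dvd_num_add_den_of_addv`), and row `(2,3,5)` of Table II (`kodairaSymbolAt_eq_IV_of_smul_eq_kubertTate_nine`).
Sharpens `kodairaSymbolAt_three_eq_IV_or_IVstar_of_nine_dvd_torsionOrder`.
[cite: BarriosRoy2022LocalData, Thm. 3.8 (table, T = C₉: type IV)] [cite: Rizzo2003, Table II (p. 4), row (2,3,5)] -/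
theorem kodairaSymbolAt_three_eq_IV_of_addOrderOf_eq_nine (hadd : Addv W 3) {P : W.toAffine.Point}
    (hP : addOrderOf P = 9) : W.kodairaSymbolAt (placeOf 3) = .IV := by
  obtain ⟨f, -, -, -, C, hC⟩ := exists_kubertTate_nine_of_addOrderOf_eq_nine W hP
  exact kodairaSymbolAt_eq_IV_of_smul_eq_kubertTate_nine hC (three_dvd_num_add_den_of_addv W hadd hC)
    (ringChar_int_quot_placeOf 3)

/-- **… with conductor exponent `f₃ = 3`** (`v₃(N) = 3`; column `v(N)` of row `(2,3,5)`).
[cite: BarriosRoy2022LocalData, Thm. 3.8 (table, T = C₉: f₃ = 3)] [cite: Rizzo2003, Table II (p. 4), row (2,3,5)] -/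
theorem conductorExponent_three_eq_three_of_addOrderOf_eq_nine (hadd : Addv W 3) {P : W.toAffine.Point}
    (hP : addOrderOf P = 9) : W.conductorExponent (placeOf 3) = 3 := by
  obtain ⟨f, -, -, -, C, hC⟩ := exists_kubertTate_nine_of_addOrderOf_eq_nine W hP
  exact conductorExponent_eq_three_of_smul_eq_kubertTate_nine hC (three_dvd_num_add_den_of_addv W hadd hC)
    (ringChar_int_quot_placeOf 3)

/-- **… and `ord₃ Δ_min = 5`** (Ogg's formula `f₃ = ord₃ Δ_min + 1 − m`, `m(IV) = 3`: the tree's DEFINITION of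
`conductorExponent`). [cite: SilvermanATAEC1994, IV.11.1 (Ogg's formula) and Table 4.1]
[cite: BarriosRoy2022LocalData, §3.5 Case 3 (v₃(Δ) = 5)] -/
theorem ordMinimalDiscriminant_three_eq_five_of_addOrderOf_eq_nine (hadd : Addv W 3) {P : W.toAffine.Point}
    (hP : addOrderOf P = 9) : W.ordMinimalDiscriminant (placeOf 3) = 5 := by
  have hf := conductorExponent_three_eq_three_of_addOrderOf_eq_nine W hadd hP
  have hK := kodairaSymbolAt_three_eq_IV_of_addOrderOf_eq_nine W hadd hP
  unfold WeierstrassCurve.conductorExponent WeierstrassCurve.numComponentsAt at hf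
  rw [hK] at hf
  simp only [KodairaSymbol.numComponents] at hf
  omega

/-- **A curve over `ℚ` with a rational point of order `9` is never of good reduction at `3`**: in Kubert's chart it is
`IV` on the fibre `3 ∣ num + den` and `I₉ₑ`, `e ≥ 1`, off it. [cite: BarriosRoy2022LocalData, Thm. 3.8 (table, T = C₉)]
[cite: Rizzo2003, Table II (p. 4), rows (2,3,5), (0,0,≥1)] -/
theorem not_hasGoodReductionAtPrime_three_of_addOrderOf_eq_nine {P : W.toAffine.Point} (hP : addOrderOf P = 9) :
    ¬ W.HasGoodReductionAtPrime 3 := by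
  obtain ⟨f, -, -, -, C, hC⟩ := exists_kubertTate_nine_of_addOrderOf_eq_nine W hP
  intro hg
  have h0 : (W.kodairaSymbolAt (placeOf 3)).IsGood :=
    (isGood_kodairaSymbolAt_iff_holds (placeOf 3) W).mpr
      ((W.hasGoodReductionAtPrime_iff_hasGoodReductionAt_holds ⟨3, Fact.out⟩).mp hg)
  by_cases h3 : (3 : ℤ) ∣ f.num + f.den
  · rw [kodairaSymbolAt_eq_IV_of_smul_eq_kubertTate_nine hC h3 (ringChar_int_quot_placeOf 3)] at h0
    exact absurd h0 (by simp [KodairaSymbol.IsGood])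
  · obtain ⟨hK, hE⟩ := kodairaSymbolAt_eq_I_of_smul_eq_kubertTate_nine hC h3 (ringChar_int_quot_placeOf 3)
    rw [hK] at h0
    simp only [KodairaSymbol.IsGood, KodairaSymbol.I.injEq] at h0
    omega

/-- The `9 ∣ #E(ℚ)_tors` forms (Mazur-free: `exists_addOrderOf_eq_nine_of_dvd_torsionOrder`): additive at `3` with
`3² ∣ #tors` ⟹ type `IV`, `f₃ = 3`, `ord₃ Δ_min = 5`. [cite: BarriosRoy2022LocalData, Thm. 3.8 (table, T = C₉)] -/
theorem kodairaIV_of_nine_dvd_torsionOrder (hadd : Addv W 3) (h9 : 3 ^ 2 ∣ W.torsionOrder) :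
    W.kodairaSymbolAt (placeOf 3) = .IV ∧ W.conductorExponent (placeOf 3) = 3 ∧
      W.ordMinimalDiscriminant (placeOf 3) = 5 := by
  obtain ⟨P, hP⟩ := exists_addOrderOf_eq_nine_of_dvd_torsionOrder W h9
  exact ⟨kodairaSymbolAt_three_eq_IV_of_addOrderOf_eq_nine W hadd hP,
    conductorExponent_three_eq_three_of_addOrderOf_eq_nine W hadd hP,
    ordMinimalDiscriminant_three_eq_five_of_addOrderOf_eq_nine W hadd hP⟩

end OneCurve

/-! ## §2 The rows of `stub_red_nineTorsionMember` -/

section Rows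

variable {W W' : WeierstrassCurve ℚ} [W.IsElliptic] [W'.IsElliptic] [Fact (Nat.Prime 3)]

/-- **On every row of the stub the `ℤ/9` member is of Kodaira type `IV` at `3`, with `f₃ = 3`, `ord₃ Δ_min = 5`**:
`W` additive at `3` (any equation), `W ∼ W'` over `ℚ`, `3² ∣ #W'(ℚ)_tors` (additivity is a `ℚ`-isogeny invariant,
`X2.addv_iff_of_isIsogenous`). [cite: BarriosRoy2022LocalData, Thm. 3.8 (table, T = C₉: type IV, f₃ = 3)]
[cite: SilvermanAEC2009, Cor. VII.7.2] -/
theorem nineTorsionMember_kodairaIV (hadd : Addv W 3) (hiso : IsIsogenous W W') (h9 : 3 ^ 2 ∣ W'.torsionOrder) :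
    W'.kodairaSymbolAt (placeOf 3) = .IV ∧ W'.conductorExponent (placeOf 3) = 3 ∧
      W'.ordMinimalDiscriminant (placeOf 3) = 5 :=
  kodairaIV_of_nine_dvd_torsionOrder W' ((X2.addv_iff_of_isIsogenous hiso).mp hadd) h9

/-- **The O6 form** (the stub's literal hypothesis `ClassO6 W 3`): on a class-O6 row with a `ℤ/9` member `W'`, the
member is of type `IV` at `3` with `f₃(W') = 3`, `ord₃ Δ_min(W') = 5`. With g5's
`nineTorsionMember_structure_of_classO6` (order-`9` point, `t = 2`, semistable away from `3`, no `ℤ/27`, `c₃ = 3`) this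
is the complete local portrait of the `ℤ/9` disjunct of crux 19190 at its wild prime.
[cite: BarriosRoy2022LocalData, Thm. 3.8 (table, T = C₉: type IV, f₃ = 3, c₃ = 3)] -/
theorem nineTorsionMember_kodairaIV_of_classO6 [W.IsGloballyMinimal] (hO : ClassO6 W 3) (hiso : IsIsogenous W W')
    (h9 : 3 ^ 2 ∣ W'.torsionOrder) :
    W'.kodairaSymbolAt (placeOf 3) = .IV ∧ W'.conductorExponent (placeOf 3) = 3 ∧
      W'.ordMinimalDiscriminant (placeOf 3) = 5 :=
  nineTorsionMember_kodairaIV hO.2.1 hiso h9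

/-- **The stub's rows never contain a `IV*` member with `9`-torsion** (closing the `IV*` branch left open by
`exists_minimalModel_of_nineTorsionMember`). [cite: BarriosRoy2022LocalData, Thm. 3.8 (table, T = C₉: type IV)] -/
theorem nineTorsionMember_kodairaSymbolAt_ne_IVstar (hadd : Addv W 3) (hiso : IsIsogenous W W')
    (h9 : 3 ^ 2 ∣ W'.torsionOrder) : W'.kodairaSymbolAt (placeOf 3) ≠ .IVstar := by
  rw [(nineTorsionMember_kodairaIV hadd hiso h9).1]
  decide

end Rows

end Summit.BirchSwinnertonDyer.BirchSwinnertonDyer.Theorems.WildUpperReducibleNineTorsionKodaira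

end
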